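import Literature.MathematicalPhysics.QuantumFieldTheory.Balaban1983to89.T3InteriorExcision
import Summits.QuantumFields.YangMills.Theses.UnitScaleTilt
import Summits.QuantumFields.YangMills.Theorems.UnitScaleTiltFluctuationComparisonRegPrPrintChiLine
import Summits.QuantumFields.YangMills.Theorems.UnitScaleTiltFluctuationComparisonRegPrPrintChiTransfer
import Literature.MathematicalPhysics.QuantumFieldTheory.Balaban1983to89.T3PrintedMinimiserExistence
import HarnessLib

/-!
# `UnitScaleTiltFluctuationComparisonRegPrInteriorChi` — «EDGE BAND TO THE TAIL», THEOREMS SIDE: 19935 ⇒ 19935ᴵ, the re-glued deciding theorem, the `S`-restricted socket,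
# the χ-good interior, and 19935ᴵ from the inner body (crux `FluctuationComparisonRegPrL` stmt-QuantumFields-19935 → 19935ᴵ; OWNER RULING ym3-torus-plan g22-№3 §B2 + ADDENDUM 1, GO 14:02:40Z)

PORT, VERBATIM (§6–§8 + the route-level implication `regPrIntL_of_regPrL` of §1), of `Cruxes/FluctuationComparisonRegPr/Sketch_ideator2_g13.lean` (ym-cruxidea-19201-2 g13, card C8
`edge-band-to-the-tail`, sha16 cc18dbdde0c8e029) into `Summit.QuantumFields.YangMills.Theorems.InteriorExcision`, over the LITERATURE sibling `…Balaban1983to89.T3InteriorExcision` (§0–§5: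
the interior text `FluctuationComparisonRegPrIntAt/IntL`, events, sandwich, tail, `unitTiltTail_of_interior`).  CREDIT: every declaration is ideator-2 g13's; the porting seat
(ym3-torus-p2 g14) changed only this docstring, the namespace/imports and ONE NAME: the sketch's `closesInt` is `ym3_of_interior` (RULING g22-№3 §B2(a)).
CONTENT: `regPrIntL_of_regPrL` (19935 ⇒ 19935ᴵ: the new text is FORMALLY WEAKER, `c = 1`); §6 `ym3_of_interior : MinimiserStabilityRegPr → FluctuationComparisonRegPrIntL → HistoryTailL →
YM3TorusSU2` (documentation of the re-glue; the route's closes-file inlines the same body); §7 `bgFluctuationIntAt_of_socketOn` (the interior comparison for one family from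
★ym-ust-19935-r1's `S`-restricted socket `PrintChi.TwoSidedRepOn S ∧ PrintChi.PintCauchyOn S` — NO edge clause) and `interior_chiGood_of_thm1GlobalMinAt` ((E1): the `c`-interior is
χ-good with print's margin `μ_L = 1 − 2/(L√L)` when `B₃c ≤ 1`, from `Thm1GlobalMinAt`); §8 `regPrIntL_of_innerChi`: 19935ᴵ ⇐ `Thm1GlobalMin L` (∀ odd L > 1) ∧ the INNER body (i)* on
doubly-χ_{μ_L}-good data ∧ window positivity `hPos` (`c := (max B₃ 1)⁻¹`, `m₀ ≥ 2`).  The variant `regPrIntL_of_innerChi'` (hPos discharged by name through the landed STUB 1) is the sibling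
`…InteriorChiPos` (kept apart while the farm rebuilds the de-natived `…CertL3Tree` oleans, R299).  Nothing of [Balaban1985UV3]∕[King1986]∕[Balaban1985Variational] is asserted.

References: T. Bałaban, CMP 102 (1985) 255–275 [Balaban1985UV3] ((41) p.266, (47) p.267, (71) p.273); CMP 102 (1985) 277–309 [Balaban1985Variational] (Thm 1 (8) p.279);
CMP 98 (1985) 17–51 [Balaban1985Averaging] (Prop. 2 (53) p.26); C. King, CMP 102 (1986) 649–677 [King1986] (Thm 3.4 (3.9)–(3.13) p.656, (3.12) p.657, Props 3.8–3.9 pp.664–665).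
-/

noncomputable section

open MeasureTheory Filter Topology Set
open Literature.MathematicalPhysics.QuantumFieldTheory.Balaban1983to89
open Literature.MathematicalPhysics.QuantumFieldTheory.Balaban1983to89.T3ContinuumYM3Torus
open Literature.MathematicalPhysics.QuantumFieldTheory.Balaban1983to89.T3LevelShift
open Literature.MathematicalPhysics.QuantumFieldTheory.Balaban1983to89.T3UnitLawDensityEML (ℰp measurableE_ℰp)
open Literature.MathematicalPhysics.QuantumFieldTheory.Balaban1983to89.T3UnitScaleTilt
open Literature.MathematicalPhysics.QuantumFieldTheory.Balaban1983to89.T3RestrictedUnitDensity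
open Literature.MathematicalPhysics.QuantumFieldTheory.Balaban1983to89.T3TiltDescent
open Literature.MathematicalPhysics.QuantumFieldTheory.Balaban1983to89.T3CruxEstimates
open Literature.MathematicalPhysics.QuantumFieldTheory.Balaban1983to89.T3RegularMinimiser
open Literature.MathematicalPhysics.QuantumFieldTheory.Balaban1983to89.T3PrintedRegularMinimiser
open Literature.MathematicalPhysics.QuantumFieldTheory.Balaban1983to89.T3PrintedMinimiserExistence
open Literature.MathematicalPhysics.QuantumFieldTheory.Balaban1983to89.T3MinimiserStabilityReduction (θBal_pos)
open Literature.MathematicalPhysics.QuantumFieldTheory.Balaban1983to89.T3ThresholdSmallness (exists_forall_θBal_le)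
open Literature.MathematicalPhysics.QuantumFieldTheory.Balaban1983to89.T3InteriorExcision
open Literature.MathematicalPhysics.QuantumFieldTheory.Balaban1983to89.Missing

namespace Summit.QuantumFields.YangMills.Theorems.InteriorExcision

/-- **19935 ⇒ 19935ᴵ**: the proposed text is FORMALLY WEAKER than the item of record. [cite: King1986, Prop. 3.8-3.9 pp.664-665] -/
theorem regPrIntL_of_regPrL (h : Theses.UnitScaleTilt.FluctuationComparisonRegPrL) : FluctuationComparisonRegPrIntL := by
  intro L
  obtain ⟨b₁, p₁, hB⟩ := h L
  refine ⟨1, b₁, p₁, one_pos, le_rfl, fun b₀ p₀ hb₁ hp₁ hb hp => ?_⟩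
  obtain ⟨ε₁, hε₁, hB'⟩ := hB b₀ p₀ hb₁ hp₁ hb hp
  refine ⟨ε₁, hε₁, fun ε₀ hε hεle => ?_⟩
  obtain ⟨m₀, hm⟩ := hB' ε₀ hε hεle
  refine ⟨m₀, fun m hmle => ?_⟩
  obtain ⟨γ₁, hγ₁, hB''⟩ := hm m hmle
  exact ⟨γ₁, hγ₁, fun F γ hL hγ hle => bgFluctuationIntAt_of_at (hB'' F γ hL hγ hle)⟩

/-! ## §6 The re-glued deciding theorem -/

/-- **`ym3_of_interior` (the sketch's `closesInt`) — THE ROUTE'S DECIDING THEOREM WITH 19935 REPLACED BY THE INTERIOR TEXT 19935ᴵ** (kernel-checked; documentation —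
the route's closes-file `plan-g22/E-INT/glue_int.lean` inlines this body over `T3InteriorExcision.unitTiltTail_of_interior`).  Order of choices:
`c, (b₁,p₁)` from 19935ᴵ at `L = F.L`; #3's profile `(b₀', p₀) ⪰ (b₁, p₁)` and its tail at every `m`; the COMPARISON PROFILE `b₀ := b₀'/c ⪰ b₁`
(so that the interior threshold `θBal(c·b₀) = θBal(b₀')` is #3's); `ε₀, m, γ⋆` as in `closes` rev 11, `γ⋆ ≤ 1`; refine below `γ⋆`; §5 for the
refined family; `continuumYM3Torus_of_refine_unitTiltTail`. [cite: King1986, Thm 3.4 (3.9)-(3.13) p.656 and (3.12) p.657] -/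
theorem ym3_of_interior (h200 : Theses.UnitScaleTilt.MinimiserStabilityRegPr) (h201 : FluctuationComparisonRegPrIntL)
    (hK2 : Theses.UnitScaleTilt.HistoryTailL) : T3YM3TorusStatement.YM3TorusSU2 := by
  refine ⟨1, one_pos, fun F γ hγ _ => ?_⟩
  obtain ⟨c, b₁, p₁, hc0, hc1, hB⟩ := h201 F.L
  obtain ⟨b₀', p₀, hb₁, hp₁, hb₀', hp₀, hT⟩ := hK2 F.L b₁ p₁
  have hb₀ : 0 < b₀' / c := div_pos hb₀' hc0
  have hb₁' : b₁ ≤ b₀' / c := by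
    refine hb₁.trans ?_
    rw [le_div_iff₀ hc0]
    exact mul_le_of_le_one_right hb₀'.le hc1
  have hcb : c * (b₀' / c) = b₀' := by field_simp
  obtain ⟨ε₁, hε₁, hA⟩ := h200 F.L
  obtain ⟨ε₁', hε₁', hB'⟩ := hB (b₀' / c) p₀ hb₁' hp₁ hb₀ hp₀
  obtain ⟨m₁, hm₁⟩ := hA (min ε₁ ε₁') (lt_min hε₁ hε₁') (min_le_left _ _)
  obtain ⟨m₂, hm₂⟩ := hB' (min ε₁ ε₁') (lt_min hε₁ hε₁') (min_le_right _ _)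
  obtain ⟨γ₂, hγ₂, hT'⟩ := hT (max (max m₁ m₂) 1) (lt_of_lt_of_le Nat.one_pos (le_max_right _ _))
  obtain ⟨γ₃, hγ₃, hA'⟩ := hm₁ (max (max m₁ m₂) 1) ((le_max_left _ _).trans (le_max_left _ _)) (b₀' / c) p₀ hb₀ hp₀
  obtain ⟨γ₄, hγ₄, hB''⟩ := hm₂ (max (max m₁ m₂) 1) ((le_max_right _ _).trans (le_max_left _ _))
  have hL : (1 : ℝ) < F.L := by exact_mod_cast F.hL.2
  have hL0 : (0 : ℝ) < F.L := zero_lt_one.trans hL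
  have hγs : 0 < min (min γ₂ (min γ₃ γ₄)) 1 := lt_min (lt_min hγ₂ (lt_min hγ₃ hγ₄)) one_pos
  obtain ⟨n, hn⟩ := ((tendsto_pow_atTop_nhds_zero_of_lt_one (inv_nonneg.mpr hL0.le)
    (inv_lt_one_of_one_lt₀ hL)).eventually (ge_mem_nhds (div_pos hγs hγ))).exists
  have hpos : 0 < γ * ((F.L : ℝ)⁻¹) ^ n := mul_pos hγ (pow_pos (inv_pos.mpr hL0) n)
  have hle : γ * ((F.L : ℝ)⁻¹) ^ n ≤ min (min γ₂ (min γ₃ γ₄)) 1 := by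
    have e := mul_le_mul_of_nonneg_left hn hγ.le
    rwa [mul_div_cancel₀ _ hγ.ne'] at e
  have hle₂ : γ * ((F.L : ℝ)⁻¹) ^ n ≤ γ₂ := hle.trans ((min_le_left _ _).trans (min_le_left _ _))
  have hle₃ : γ * ((F.L : ℝ)⁻¹) ^ n ≤ γ₃ :=
    hle.trans ((min_le_left _ _).trans ((min_le_right _ _).trans (min_le_left _ _)))
  have hle₄ : γ * ((F.L : ℝ)⁻¹) ^ n ≤ γ₄ :=
    hle.trans ((min_le_left _ _).trans ((min_le_right _ _).trans (min_le_right _ _)))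
  have hle1 : γ * ((F.L : ℝ)⁻¹) ^ n ≤ 1 := hle.trans (min_le_right _ _)
  have hTn : HistoryTailAt (F.refine n) (γ * ((F.L : ℝ)⁻¹) ^ n) (c * (b₀' / c)) p₀ (max (max m₁ m₂) 1) := by
    rw [hcb]
    exact hT' (F.refine n) _ rfl hpos hle₂
  have hst : BgStabilityAt (F.refine n) (γ * ((F.L : ℝ)⁻¹) ^ n) (b₀' / c) p₀ (max (max m₁ m₂) 1)
      (bgRegPr (F.refine n) (γ * ((F.L : ℝ)⁻¹) ^ n) (max (max m₁ m₂) 1) (min ε₁ ε₁'))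
      (bgRegPr' (F.refine n) (γ * ((F.L : ℝ)⁻¹) ^ n) (max (max m₁ m₂) 1) (min ε₁ ε₁')) :=
    hA' (F.refine n) _ rfl hpos hle₃
  have hfl : BgFluctuationIntAt (F.refine n) (γ * ((F.L : ℝ)⁻¹) ^ n) (b₀' / c) p₀ (max (max m₁ m₂) 1)
      (bgRegPr (F.refine n) (γ * ((F.L : ℝ)⁻¹) ^ n) (max (max m₁ m₂) 1) (min ε₁ ε₁'))
      (bgRegPr' (F.refine n) (γ * ((F.L : ℝ)⁻¹) ^ n) (max (max m₁ m₂) 1) (min ε₁ ε₁')) c :=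
    hB'' (F.refine n) _ rfl hpos hle₄
  obtain ⟨r, w, w', hr, hw, hw', h⟩ := unitTiltTail_of_interior hpos hle1 hb₀ hc1 hst hfl hTn
  exact continuumYM3Torus_of_refine_unitTiltTail F ℰp measurableE_ℰp n hγ.le hr hw hw' h

/-! ## §7 Why the interior text is easier: the inner socket alone feeds it, and the interior is doubly χ-good -/

section Socket

variable {F : T3Family} {γ b₀ p₀ ε₀ c : ℝ} {m : ℕ}

/-- **THE INTERIOR COMPARISON FROM THE `S`-RESTRICTED SOCKET — NO EDGE CLAUSE.**  For one family: ★r1's restricted socket (`TwoSidedRepOn S`: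
[Balaban1985UV3] (41)∧(47) pinned, asserted on data satisfying `S`; `PintCauchyOn S`: King's cut-off-Cauchy property of the interaction sums on
doubly-`S` data), ANY predicate `S` that the `c`-interior implies for both runs almost everywhere, and positivity of both densities on the
interior (steps `K ≥ 1`) give `FluctuationComparisonRegPrIntAt F γ b₀ p₀ m c ε₀` (`…PrintChiLine.stubBodyOn_of_repOn_of_cauchyOn` by name).
With `S := ChiGood(μ_L)` and `m ≥ 2` the hypothesis `hS` is (E1) below (`⌊K/m⌋ < K` for `K ≥ 1`). [cite: King1986, Prop. 3.8-3.9 pp.664-665] -/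
theorem bgFluctuationIntAt_of_socketOn (hm : 0 < m)
    (S : (K n : ℕ) → n ≤ K → GaugeField (F.P n) 0 (Matrix.specialUnitaryGroup (Fin 2) ℂ) → Prop)
    {Pint : (K n : ℕ) → GaugeField (F.P n) 0 (Matrix.specialUnitaryGroup (Fin 2) ℂ) → ℝ} {E Rm : ℕ → ℕ → ℝ}
    (hrep : Theorems.PrintChi.TwoSidedRepOn F γ b₀ p₀ S ε₀ Pint E Rm) (hcauchy : Theorems.PrintChi.PintCauchyOn F γ b₀ p₀ S m Pint)
    (hcθ : ∀ i, θBal F.L γ (c * b₀) p₀ i ≤ θBal F.L γ b₀ p₀ i)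
    (hS : ∀ K, 0 < K → ∀ᵐ V ∂fieldMeasure (F.P (K / m)) 0 (Matrix.specialUnitaryGroup (Fin 2) ℂ),
      PlaqSmall (θBal F.L γ (c * b₀) p₀ (K / m)) V →
        S K (K / m) (Nat.div_le_self K m) V ∧ S (K + 1) (K / m) ((Nat.div_le_self K m).trans (Nat.le_succ K)) V)
    (hposI : ∀ K, 0 < K → ∀ᵐ V ∂fieldMeasure (F.P (K / m)) 0 (Matrix.specialUnitaryGroup (Fin 2) ℂ),
      PlaqSmall (θBal F.L γ (c * b₀) p₀ (K / m)) V →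
        0 < heightDensity F γ (Nat.div_le_self K m) (histGood F ℰp (θBal F.L γ b₀ p₀) K (K / m)) V ∧
        0 < heightDensity F γ ((Nat.div_le_self K m).trans (Nat.le_succ K)) (histGood F ℰp (θBal F.L γ b₀ p₀) (K + 1) (K / m)) V) :
    FluctuationComparisonRegPrIntAt F γ b₀ p₀ m c ε₀ := by
  obtain ⟨r, κ, hr, hr0, hae⟩ :=
    Theorems.PrintChi.stubBodyOn_of_repOn_of_cauchyOn F γ b₀ p₀ ε₀ hm S Pint E Rm hrep hcauchy
  refine ⟨r, κ, hr, hr0, fun K hK => ?_⟩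
  filter_upwards [hae K, hS K hK, hposI K hK] with V hV hSV hpV hs
  obtain ⟨h0, h1⟩ := hpV hs
  obtain ⟨hs0, hs1⟩ := hSV hs
  exact ⟨h0, h1, hV (fun p => (hs p).trans_le (hcθ _)) hs0 hs1 h0 h1⟩

/-- **(E1) THE DEEP INTERIOR IS χ-GOOD, FROM [Balaban1985Variational] THM 1 (8) IN THE TREE'S GLOBAL READING `Thm1GlobalMinAt`** — at BLOCK-SIZE
LEVEL (the coupling threshold depends on `L, b₀, p₀, ε₀, a₁, B₃, c` only, so it hoists above `∀ F`).  If `B₃·c ≤ 1` then below the threshold every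
datum `V` with `PlaqSmall (θBal(c·b₀) n) V` (`n < K`) is χ-good for run `K` with print's margin `μ_L = 1 − 2/(L√L)`: Thm 1 at radius
`ε₁ := θBal(c·b₀)(n) = c·θBal(b₀)(n)` (`≤ a₁`, `B₃ε₁ ≤ ε₀ ≤ a₀` for small `γ`) puts the minimiser in (8) — finest plaquettes `< B₃ε₁η^{2(K−n)} ≤
θBal(b₀)(n)η^{2(K−n)}`, print's `χ_k` — and `…PrintChiTransfer.chiGood_of_printChi_sharp` ([Balaban1985Averaging] Prop. 2 (53)) does the rest.  ANY
finite `B₃(L)` serves (`c := B₃⁻¹ ∧ 1`): no «margin < 1» condition, no block-size restriction. [cite: Balaban1985Variational, Thm 1 (8) p.279] -/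
theorem interior_chiGood_of_thm1GlobalMinAt {L : ℕ} (hL : 1 ≤ L) {a₀ a₁ B₃ : ℝ} (hT : Thm1GlobalMinAt L a₀ a₁ B₃) (ha₁ : 0 < a₁)
    (hB₃ : 0 < B₃) (hb : 0 < b₀) (hp : 0 ≤ p₀) (hε₀ : 0 < ε₀) (hε₀a : ε₀ ≤ a₀) (hc0 : 0 < c) (hcB : B₃ * c ≤ 1) :
    ∃ γ₁ : ℝ, 0 < γ₁ ∧ γ₁ ≤ 1 ∧ ∀ (F : T3Family) (γ : ℝ), F.L = L → 0 < γ → γ ≤ γ₁ → ∀ {n K : ℕ} (hnK : n < K)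
      (V : GaugeField (F.P n) 0 (Matrix.specialUnitaryGroup (Fin 2) ℂ)),
      PlaqSmall (θBal F.L γ (c * b₀) p₀ n) V →
        Theorems.PrintChi.ChiGood F γ b₀ p₀ ε₀ (1 - 2 / ((F.L : ℝ) * Real.sqrt F.L)) hnK.le V := by
  have hL0 : (0 : ℝ) < L := by exact_mod_cast (show 0 < L by omega)
  -- print's two averaging constants, exactly as in `…PrintChiTransfer.exists_coupling_chiGood_of_printChi`
  have hC₀ : (0 : ℝ) < 143 * ((((3 + 4 : ℕ) : ℝ)) ^ 2 / 4) ^ 2 := by positivity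
  have h7L : (0 : ℝ) < (((3 + 4) * L : ℕ) : ℝ) ^ 2 := by
    have : 0 < (3 + 4) * L := by omega
    positivity
  obtain ⟨γ₀, hγ₀, hsmall₀⟩ := exists_forall_θBal_le hL b₀ p₀
    (lt_min (div_pos (by norm_num : (0 : ℝ) < 1 / 3) hC₀) (div_pos ExpMeanLog.deltaSU_pos h7L) :
      (0 : ℝ) < min (1 / 3 / (143 * ((((3 + 4 : ℕ) : ℝ)) ^ 2 / 4) ^ 2)) (ExpMeanLog.deltaSU (Fin 2) / (((3 + 4) * L : ℕ) : ℝ) ^ 2))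
  obtain ⟨γ_b, hγ_b, hsmall⟩ := exists_forall_θBal_le hL (c * b₀) p₀ (lt_min ha₁ (div_pos hε₀ hB₃))
  refine ⟨min (min γ₀ γ_b) 1, lt_min (lt_min hγ₀ hγ_b) one_pos, min_le_right _ _, fun F γ hF hγ hγle n K hnK V hV => ?_⟩
  subst hF
  have hLs : 0 < (F.L : ℝ) * Real.sqrt F.L := by positivity
  have hγa : γ ≤ γ₀ := hγle.trans ((min_le_left _ _).trans (min_le_left _ _))
  have hγb : γ ≤ γ_b := hγle.trans ((min_le_left _ _).trans (min_le_right _ _))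
  have hγ1 : γ ≤ 1 := hγle.trans (min_le_right _ _)
  have hcb : 0 < c * b₀ := mul_pos hc0 hb
  have hε₁ : 0 < θBal F.L γ (c * b₀) p₀ n := θBal_pos hL hγ hγ1 hcb p₀ n
  have hθ := hsmall γ hγ hγb n
  have hε₁a : θBal F.L γ (c * b₀) p₀ n ≤ a₁ := hθ.trans (min_le_left _ _)
  have hlo : B₃ * θBal F.L γ (c * b₀) p₀ n ≤ ε₀ := by
    have h := hθ.trans (min_le_right _ _)
    rwa [le_div_iff₀ hB₃, mul_comm] at h
  obtain ⟨U, hU8, hmin⟩ := hT F rfl n K hnK _ ε₀ hε₁ hε₁a hlo hε₀a V hV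
  have hU6 : U ∈ regFibrePr F n K hnK.le ε₀ V := regFibrePr_mono F hlo V hU8
  have hminEq := minActionRegPr_eq_of_isMinOn F hU6 hmin
  -- print's `χ_k` for the minimiser: finest plaquettes `< B₃·θBal(c b₀)(n)·η² ≤ θBal(b₀)(n)·η²`
  have hχU : PlaqSmall (θBal F.L γ b₀ p₀ n * ((F.L : ℝ)⁻¹) ^ (2 * (K - n))) U := by
    have h8 : PlaqSmall (regThreshold F n K (B₃ * θBal F.L γ (c * b₀) p₀ n)) U := ((mem_regFibrePr_iff F).mp hU8).2.1
    refine fun p => (h8 p).trans_le ?_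
    show B₃ * θBal F.L γ (c * b₀) p₀ n * ((F.L : ℝ)⁻¹) ^ (2 * (K - n)) ≤ θBal F.L γ b₀ p₀ n * ((F.L : ℝ)⁻¹) ^ (2 * (K - n))
    refine mul_le_mul_of_nonneg_right ?_ (pow_nonneg (inv_nonneg.mpr (Nat.cast_nonneg _)) _)
    rw [θBal_mul, ← mul_assoc]
    exact mul_le_of_le_one_left (θBal_pos hL hγ hγ1 hb p₀ n).le hcB
  have hθc := hsmall₀ γ hγ hγa n
  refine Theorems.PrintChi.chiGood_of_printChi_sharp hγ hγ1 hb hp hnK.le hU6 hminEq hχU ?_ ?_ (le_of_eq ?_)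
  · have h1 : θBal F.L γ b₀ p₀ n ≤ 1 / 3 / (143 * ((((3 + 4 : ℕ) : ℝ)) ^ 2 / 4) ^ 2) := hθc.trans (min_le_left _ _)
    rwa [le_div_iff₀ hC₀, mul_comm] at h1
  · have h2 : θBal F.L γ b₀ p₀ n ≤ ExpMeanLog.deltaSU (Fin 2) / (((3 + 4) * F.L : ℕ) : ℝ) ^ 2 := hθc.trans (min_le_right _ _)
    rw [mul_div_assoc]
    linarith
  · field_simp
    ring

end Socket

/-! ## §8 19935ᴵ at block-size level from the inner socket body and window positivity -/

section BlockSize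

/-- **19935ᴵ ⇐ THE INNER BODY FOR EVERY ODD BLOCK SIZE + WINDOW POSITIVITY + THM 1.**  Hypotheses, all with the route's quantifier prefix:
`hThm1` = [Balaban1985Variational] Thm 1 + Prop 7 in the tree's global reading at every odd `L > 1` (a DISPLAYED schema of the line of record:
`AlphaInputsT3ACMinimiserPinTriv`, `HasRegMinimisersPrAt`); `hInner` = for every odd `L > 1` ★r1's sanctioned INNER stub body (i)* — the registered
4′ body asserted only at data χ-good for BOTH runs with print's margin `μ_L` (verbatim the `hInner` of `…PrintChiSocket.stub_logComparisonSmallBlocks_of_chi_edge`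
WITHOUT the restriction `L < 7`; for `L ≥ 7` it is implied outright by the full-window body of the large-`L` chain (3⁗ + socket));
`hPos` = positivity of both restricted densities on the window, verbatim the conclusion shape of the LANDED
`OneStepSubmersion.posOnSmall_of_oneStepSmallLift` (p446430 ∘ p490827; discharged by name in `regPrIntL_of_innerChi'`).  Conclusion: the proposed
item text `FluctuationComparisonRegPrIntL` — with `c := (max B₃ 1)⁻¹`, `m₀ ≥ 2`.  NO edge-oscillation clause (ii)* and NO `K = 0` corner anywhere.
[cite: Balaban1985UV3, (41) p.266 and (47) p.267] -/
theorem regPrIntL_of_innerChi (hThm1 : ∀ L : ℕ, Odd L → 1 < L → Thm1GlobalMin L)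
    (hInner : ∀ L : ℕ, Odd L → 1 < L → ∃ (b₁ p₁ : ℝ), ∀ (b₀ p₀ : ℝ), b₁ ≤ b₀ → p₁ ≤ p₀ → 0 < b₀ → 2 < p₀ →
      ∃ ε₁ : ℝ, 0 < ε₁ ∧ ∀ (ε₀ : ℝ), 0 < ε₀ → ε₀ ≤ ε₁ → ∃ m₀ : ℕ, ∀ (m : ℕ), m₀ ≤ m →
        ∃ γ₁ : ℝ, 0 < γ₁ ∧ ∀ (F : T3Family) (γ : ℝ), F.L = L → 0 < γ → γ ≤ γ₁ →
          ∃ (r κ : ℕ → ℝ), Summable r ∧ (∀ K, 0 ≤ r K) ∧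
            ∀ K, ∀ᵐ V ∂fieldMeasure (F.P (K / m)) 0 (Matrix.specialUnitaryGroup (Fin 2) ℂ),
              PlaqSmall (θBal F.L γ b₀ p₀ (K / m)) V →
                Theorems.PrintChi.ChiGood F γ b₀ p₀ ε₀ (1 - 2 / ((F.L : ℝ) * Real.sqrt F.L)) (Nat.div_le_self K m) V →
                Theorems.PrintChi.ChiGood F γ b₀ p₀ ε₀ (1 - 2 / ((F.L : ℝ) * Real.sqrt F.L))
                    ((Nat.div_le_self K m).trans (Nat.le_succ K)) V →
                0 < heightDensity F γ (Nat.div_le_self K m) (histGood F ℰp (θBal F.L γ b₀ p₀) K (K / m)) V →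
                0 < heightDensity F γ ((Nat.div_le_self K m).trans (Nat.le_succ K))
                      (histGood F ℰp (θBal F.L γ b₀ p₀) (K + 1) (K / m)) V →
                  |(Real.log (heightDensity F γ ((Nat.div_le_self K m).trans (Nat.le_succ K))
                        (histGood F ℰp (θBal F.L γ b₀ p₀) (K + 1) (K / m)) V) + bgRegPr' F γ m ε₀ K V) -
                    (Real.log (heightDensity F γ (Nat.div_le_self K m) (histGood F ℰp (θBal F.L γ b₀ p₀) K (K / m)) V) +
                      bgRegPr F γ m ε₀ K V) - κ K| ≤ r K)
    (hPos : ∀ (L m : ℕ), 0 < m → ∀ (b₀ p₀ : ℝ), 0 < b₀ → 2 < p₀ → ∃ γ₁ : ℝ, 0 < γ₁ ∧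
      ∀ (F : T3Family) (γ : ℝ), F.L = L → 0 < γ → γ ≤ γ₁ →
        ∀ K, ∀ᵐ V ∂fieldMeasure (F.P (K / m)) 0 (Matrix.specialUnitaryGroup (Fin 2) ℂ),
          PlaqSmall (θBal F.L γ b₀ p₀ (K / m)) V →
            0 < heightDensity F γ (Nat.div_le_self K m) (histGood F ℰp (θBal F.L γ b₀ p₀) K (K / m)) V ∧
            0 < heightDensity F γ ((Nat.div_le_self K m).trans (Nat.le_succ K))
                  (histGood F ℰp (θBal F.L γ b₀ p₀) (K + 1) (K / m)) V) :
    FluctuationComparisonRegPrIntL := by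
  intro L
  by_cases hL : Odd L ∧ 1 < L
  swap
  · -- no family has this block size
    refine ⟨1, 0, 0, one_pos, le_rfl, fun b₀ p₀ _ _ _ _ => ⟨1, one_pos, fun ε₀ _ _ => ⟨0, fun m _ => ⟨1, one_pos, ?_⟩⟩⟩⟩
    intro F γ hF
    exact absurd (hF ▸ F.hL : Odd L ∧ 1 < L) hL
  obtain ⟨a₀, a₁, B₃, ha₀, ha₁, hB₃, -, hT⟩ := hThm1 L hL.1 hL.2
  obtain ⟨b₁, p₁, hI⟩ := hInner L hL.1 hL.2
  have hM : 0 < max B₃ 1 := lt_max_of_lt_right one_pos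
  have hc0 : 0 < (max B₃ 1)⁻¹ := inv_pos.mpr hM
  have hc1 : (max B₃ 1)⁻¹ ≤ 1 := inv_le_one_of_one_le₀ (le_max_right _ _)
  have hcB : B₃ * (max B₃ 1)⁻¹ ≤ 1 := by
    rw [← div_eq_mul_inv, div_le_one hM]
    exact le_max_left _ _
  refine ⟨(max B₃ 1)⁻¹, b₁, p₁, hc0, hc1, fun b₀ p₀ hb₁ hp₁ hb hp => ?_⟩
  obtain ⟨ε₁, hε₁, hI1⟩ := hI b₀ p₀ hb₁ hp₁ hb hp
  refine ⟨min ε₁ a₀, lt_min hε₁ ha₀, fun ε₀ hε₀ hε₀le => ?_⟩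
  obtain ⟨m₀, hI2⟩ := hI1 ε₀ hε₀ (hε₀le.trans (min_le_left _ _))
  refine ⟨max m₀ 2, fun m hm => ?_⟩
  have hm2 : 2 ≤ m := (le_max_right _ _).trans hm
  obtain ⟨γ₁, hγ₁, hI3⟩ := hI2 m ((le_max_left _ _).trans hm)
  obtain ⟨γE, hγE, hγE1, hE1⟩ := interior_chiGood_of_thm1GlobalMinAt hL.2.le hT ha₁ hB₃ hb (zero_le_two.trans hp.le) hε₀
    (hε₀le.trans (min_le_right _ _)) hc0 hcB
  obtain ⟨γP, hγP, hP⟩ := hPos L m (by omega) b₀ p₀ hb hp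
  refine ⟨min (min γ₁ γE) γP, lt_min (lt_min hγ₁ hγE) hγP, fun F γ hF hγ hγle => ?_⟩
  have hγ₁' : γ ≤ γ₁ := hγle.trans ((min_le_left _ _).trans (min_le_left _ _))
  have hγE' : γ ≤ γE := hγle.trans ((min_le_left _ _).trans (min_le_right _ _))
  have hγP' : γ ≤ γP := hγle.trans (min_le_right _ _)
  obtain ⟨r, κ, hr, hr0, hbody⟩ := hI3 F γ hF hγ hγ₁'
  have hγ1 : γ ≤ 1 := hγE'.trans hγE1
  have hcθ : ∀ i, θBal F.L γ ((max B₃ 1)⁻¹ * b₀) p₀ i ≤ θBal F.L γ b₀ p₀ i :=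
    fun i => θBal_mul_le F.hL.2.le hγ hγ1 hb hc1 p₀ i
  refine ⟨r, κ, hr, hr0, fun K hK => ?_⟩
  have hlt : K / m < K := Nat.div_lt_self hK (by omega)
  have hlt' : K / m < K + 1 := hlt.trans (Nat.lt_succ_self K)
  filter_upwards [hbody K, hP F γ hF hγ hγP' K] with V hb' hpV hs
  have hsw : PlaqSmall (θBal F.L γ b₀ p₀ (K / m)) V := fun p => (hs p).trans_le (hcθ _)
  obtain ⟨h0, h1⟩ := hpV hsw
  exact ⟨h0, h1, hb' hsw (hE1 F γ hF hγ hγE' hlt V hs) (hE1 F γ hF hγ hγE' hlt' V hs) h0 h1⟩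

end BlockSize

end Summit.QuantumFields.YangMills.Theorems.InteriorExcision

end
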